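import Mathlib
import Summits.QuantumFields.YangMills.Theses.FlatTubeReduction
import Summits.QuantumFields.YangMills.Theorems.FlatTubeReductionRecordProfileAnalyticInput
import Summits.QuantumFields.YangMills.Theorems.FlatTubeReductionRateTwoZonePow
import Summits.QuantumFields.YangMills.Theorems.FlatTubeReductionShellGainOfSmall
import Summits.QuantumFields.YangMills.Theorems.FlatTubeReductionRecordAnalyticRate
import Summits.QuantumFields.YangMills.Theorems.FlatTubeReductionSoftTubeRatePot
import Summits.QuantumFields.YangMills.Theorems.FlatTubeReductionBOAssemblyRatePot
import Summits.QuantumFields.YangMills.Theorems.FlatTubeReductionHODPotA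
import Summits.QuantumFields.YangMills.Theorems.FlatTubeReductionCentralQuasimodeThird
import Summits.QuantumFields.YangMills.Theorems.LuscherReductionTwistedTraceScalingValleyGainRecord
import Summits.QuantumFields.YangMills.Theorems.FlatTubeReductionStiffKHST

/-!
# SKELETON «ratepack-v8» — FINAL (g20 08:4xZ): ALL STUBS LANDED; `stub_hST_A` := ✓`ConstTube.stub_hST_A` (Theorems/FlatTubeReductionStiffKHST.lean, p766693); the crux is PROVED:
# ✓`FlatTubeReduction.nearFlatRatioLaw_proof` (Theorems/FlatTubeReductionNearFlatRatioLaw.lean, p766780; item 24720 CLOSED·proved 2026-08-30T08:37:24Z).  This workfile is kept sorry-free for the record.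
# (was) SKELETON «ratepack-v8» (LEAD-successor ym-line-ftr-p1 g20, 2026-08-30: `stub_shellGainSmall` is NO LONGER A STUB — lane A's ✓`…ValleyGainRecord.shellGain_record (hL2) (0 < a < 1/5) (b)`
# at `a = 1/6` + ✓`innerShellGainAt_of_small_record` give the glue hypothesis `InnerShellGainAt L (powScale (1/6)) (powScale (1/40))` for every `L ≥ 2` (`shellGain_sixth` below);
# ONE stub remains: `stub_hST_A` = the K-port `43 → 42·max 1 (|Λ|/7) + 1` of lane A's UNCONDITIONAL ✓`hST_record_low` at `s = 1/6` (this seat, files `Theorems/FlatTubeReductionStiffK*.lean`).)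
# (was) SKELETON «ratepack-v7.2» (g19 09:4xZ: `stub_hST_A` RESHAPED (weakened) to lane A's quantifier order `∃ M₁ ∀ M ≥ M₁ ∃ θ_A ∈ (0,1] ∀ᶠ β …` — exactly the shape of their
# UNCONDITIONAL ✓`hST_record_low` at K = 43; what remains is its port to the cap constant K = 42D+1 — glue `coreRate_of_stubs` re-proved choosing M first)
# (was) SKELETON «ratepack-v7.1» (g19 08:5xZ: `stub_C1rate` LANDED — Theorems/FlatTubeReductionCentralQuasimodeThird.lean; TWO stubs remain: `stub_hST_A` [lane A], `stub_shellGainSmall` [lane B]; the whole (B-OD)-with-potential half of the analytic input is now a THEOREM)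
# (was) SKELETON «ratepack-v7» (LEAD-successor ym-line-ftr-p1 g19, 2026-08-30; RESHAPE of «ratepack-v6»: the XL stub `stub_hODpot_A` is now a THEOREM modulo ONE smaller analytic stub —
# `hODpot_A_of_stub := …HODPotA.hODpot_A_of_quasimode ∘ stub_C1rate` (Theorems/FlatTubeReductionHODPotA.lean + 20 supports p758872 … p763327, crux workfile
# `Lines/ratepack-v8-core-g19.md`); the new stub `stub_C1rate` is the CENTRAL QUASIMODE OF THE CORE FIBRE TRANSFER AT RATE `η = O(β^{-1/3})` (lane A's ✓`central_quasimode_rate`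
# has the same shape with `η = β^{-1/5}`); the namespace `RatePackV6` is kept so that the FQNs of the two untouched stubs do not move.)
# WAS: SKELETON «ratepack-v6» (LEAD ym-line-ftr-p1 g17, 2026-08-29; RESHAPE of «ratepack-v2»: the XL stub `stub_coreRateOfEM` is REPLACED by the two analytic bricks it was made of,
# stated in LANE A's CURRENCY for the un-normalised record profile — everything else of the analytic rate input (profile/normaliser/dressing package at radius `r_B`, exact (B-N),
# (B-T)-rate, the (B-ST)/(B-OD) transfers to the normalised profile, the structure `AnalyticRatePotInput`) is now a THEOREM: `RateTube.recordProfile_analyticInput_of_hST_hOD`,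
# Theorems/FlatTubeReductionRecordProfileAnalyticInput.lean, with its supports p740397 … p743821) for the crux K1 `NearFlatRatioLaw` (stmt-QuantumFields-24720, route `FlatTubeReduction`).

THE LINE (crux workfiles `Lines/ratepack_v2.md`, `ratepack-v3-frozen-g12.md`, `ratepack-v5-nearpair-g16.md`, `ratepack-v6-port-g17.md`): two zones at core exponent `s = 1/6`; the CORE RATE
for every `L ≥ 2` from ONE inhabitant of `RateTube.AnalyticRatePotInput L D_L M` (`D_L = max 1 (|Site 3 L|/7)`, window `D_L·recordDelta1 L (1/6)`, weight `recordChi L (1/6) (42D_L+1) M`)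
via `AnalyticRatePotInput.toRecord → boRateBricksPot_record → softTubeBORatePackagePotOn_of_bricksPot → innerRateAt_of_ratePackagePot` ((EM) is the theorem
`RateTube.oneSiteEigenMoments`); the inhabitant from the two stubs below by `recordProfile_analyticInput_of_hST_hOD` (profile of record = lane A's cap-balanced stiff Gaussian
`recordProfile L` at fibre radius `r_B = min (1/40) (β^{-1/2}·btLog β)`, normalised by `n_β`; `θ₀ = θ_A/2`, `b = 3b_A`, `κ_b = 54κ_A`); then lane A's SHELL (third stub) and the two-zone glue.
THREE STUBS (v7):
* `stub_C1rate` — see its docstring (replaces v6's `stub_hODpot_A`, which is now the theorem `hODpot_A_of_stub`);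
* `stub_hST_A` — lane A's (B-ST) (their C4-CORE pen, crux 20203; abstract layer `…BOStiffAssembly.hST_of_pieces` landed, Record instance files landing) AT THE RATE TWIN'S WINDOW
  `(s, K) = (1/6, 42D_L+1)` for `Ω_c = recordProfile L`, constant `Λ_A = btC(Ω_c, btEps, 5xℓ²)/fpZ/recordGamma·λ₀`, some gap `θ_A ∈ (0,1]` [M once lane A's K = 43 statement is K-generic];
* `stub_hODpot_A` — the (B-OD) brick WITH SECOND-MOMENT POTENTIAL at rate `b_A² = O(λ_b(L³β)²)` for `Ω_c` in lane A's currency [HARDEST, XL: lane A's ✓`hOD_record` gives `b² = o(λ_b)`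
  without potential; the rate needs (C1) the central quasimode at `O(β^{-1/3})` (NP-L differenced remainder) and (C2) the transport colour term in `L²` (κ_b = O(1)); (C3)–(C5) re-usable];
* (`stub_shellGainSmall` — lane A's typed C4-SHELL at `a = 1/5`; RETIRED in v8: the glue needs only `a = 1/6`, which is lane A's ✓`shellGain_record`.)
HONEST FRAMING: all three stubs are OPEN fixed-lattice semiclassics; femto rung R2b1 (RECORD label); not infinite volume, not a mass gap, not Clay.  No summit is proved.
-/

set_option autoImplicit false

noncomputable section

open MeasureTheory Filter Topology
open Literature.MathematicalPhysics.QuantumFieldTheory hiding SU2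
open Literature.MathematicalPhysics.QuantumLattice
open Summit.QuantumFields.YangMills.Theorems.FemtoTransferGap
open Summit.QuantumFields.YangMills.Theorems.FemtoTransferGap.TwoLattice
open Summit.QuantumFields.YangMills.Theorems.FemtoTransferGap.TwoLattice.ConstTube
open Summit.QuantumFields.YangMills.Theorems.FemtoTransferGap.TwoLattice.Avg
open Summit.QuantumFields.YangMills.Theorems.FemtoTransferGap.RateTube
open Summit.QuantumFields.YangMills.Theorems.FemtoTransferGap.TwoLattice.GnChart
open Summit.QuantumFields.YangMills.Theorems.FemtoTransferGap.TwoLattice.Stiff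
open Summit.QuantumFields.YangMills.Theorems.FemtoTransferGap.TwoLattice.Cov
open scoped BigOperators

namespace Summit.QuantumFields.YangMills.Cruxes.NearFlatRatioLaw.RatePackV6

/-- stub (lane A's (B-ST) pen at the rate twin's window; M; v7.2: QUANTIFIER ORDER RELAXED to lane A's own deliverable shape `∃ M₁ ∀ M ≥ M₁ ∃ θ_A` — cf. their
✓`…BOStiffHSTLow.hST_record_low` (K = 43, every `0 < s ≤ 1/3`, `θ₀ = θ₀(L,M)`); the glue picks `M` first): the STIFF GAP for the un-normalised record profile — for every `L ≥ 2` there is `M₁` such that for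
every `M ≥ M₁` there is a gap `θ_A ∈ (0,1]` with, eventually in `β`, every bounded measurable `v` supported in `{recordChi L (1/6) (42D_L+1) M β ≠ 0}` (`D_L = max 1 (|Site 3 L|/7)`) and fibre-orthogonal to
`recordProfile L β` (`fibreInner … v u = 0` for all slow data `u`) has `tubeForm β v ≤ (1 − θ_A)·((btC/fpZ/recordGamma)·λ₀(1,L³β))·tubeNormSq (softWeight χ_β) v`. -/
theorem stub_hST_A :
    ∀ (L : ℕ) [NeZero L], 2 ≤ L → ∃ M₁ : ℝ, ∀ M : ℝ, M₁ ≤ M → ∃ θA : ℝ, 0 < θA ∧ θA ≤ 1 ∧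
      ∀ᶠ β : ℝ in atTop, ∀ v : GaugeConfig 3 L SU2 → ℝ, Measurable v → (∃ C : ℝ, ∀ U, |v U| ≤ C) →
        (∀ U, v U ≠ 0 → recordChi L (1 / 6) (42 * max 1 ((Fintype.card (Site 3 L) : ℝ) / 7) + 1) M β U ≠ 0) →
        (∀ u, fibreInner L (softWeight (recordChi L (1 / 6) (42 * max 1 ((Fintype.card (Site 3 L) : ℝ) / 7) + 1) M β)) (recordProfile L β) v u = 0) →
        tubeForm β v ≤ (1 - θA) * (btC L β (recordProfile L β) (btEps β) (5 * (powScale (1 / 2) β * btLog β ^ 2)) / fpZ (btEps β) / recordGamma L (recordProfile L) β *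
            levelValue su2Rep 1 ((L : ℝ) ^ 3 * β) 0) *
          tubeNormSq (softWeight (recordChi L (1 / 6) (42 * max 1 ((Fintype.card (Site 3 L) : ℝ) / 7) + 1) M β)) v := fun L _ hL =>
  Summit.QuantumFields.YangMills.Theorems.FemtoTransferGap.TwoLattice.ConstTube.stub_hST_A L hL

/-- (v7.1: LANDED — `…CentralQuasimodeThird.stub_C1rate`, p764693; no longer a stub) formerly stub (v7; the ONE remaining analytic input of the (B-OD)-with-potential brick — (C1)+(C2) of the line memos: the CENTRAL QUASIMODE OF THE CORE FIBRE TRANSFER AT RATE):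
for every `L ≥ 2` there are `c₁(β) > 0` and a relative defect `η(β) ≥ 0` with `η² = O(λ_b(L³β)²)` (i.e. `η = O(β^{-1/3})`) such that, eventually in `β`, for every cap-balanced
`v'` in the link box `|v' e c| ≤ 9L·5β^{-1/2}ℓ² + β^{-1}` with `‖linkEmbed v'‖ ≤ r_B/12`, the core fibre transfer of lane A's record profile at `orthoTube L 1 v'` equals `c₁·M(v')` up to
the relative error `η`, `M(v') = stiffGaussTop·e^{-q̃(v')}/I₀` (VERBATIM the hypothesis `hquasi` of `…CoreDefectRecordOrbitMomentsQuasi` / `…HODPotA.hODpot_A_of_quasimode`;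
lane A's ✓`…BOCentralQuasimodeRate.central_quasimode_rate` is exactly this with `η = β^{-1/5}`, which is NOT at rate).  [L: NP-L differenced remainder for the slow factor
(smearing window `δ_u = β^{-1/2}ℓ²`) + stiff Laplace at weight `β^{1/3}`; memo `Lines/ratepack-v8-core-g19.md` §3.] -/
theorem stub_C1rate :
    ∀ (L : ℕ) [NeZero L], 2 ≤ L → ∃ c₁ η : ℝ → ℝ,
      (∃ a : ℝ, ∀ᶠ β : ℝ in atTop, η β ^ 2 ≤ a * bareLambda ((L : ℝ) ^ 3 * β) ^ 2) ∧
      (∀ᶠ β : ℝ in atTop, 0 < c₁ β ∧ 0 ≤ η β ∧ ∀ v' : Edge 3 L → Fin 3 → ℝ, v' ∈ capBalancedSet L →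
      (∀ (e : Edge 3 L) (c : Fin 3), |v' e c| ≤ (9 * (L : ℝ) * (5 * (powScale (1 / 2) β * btLog β ^ 2)) + (powScale 1 β))) → ‖linkEmbed L v'‖ ≤ (min (1 / 40) (powScale (1 / 2) β * btLog β)) / 12 →
      |fpFibreTransfer L β (fun x : LinkSpace L => {x : LinkSpace L | linkCurry x ∈ capBalancedSet L}.indicator (fun _ => (1 : ℝ)) x * frozenProfile L (fun β' => stiffGaussExp L (β' / 2) β') (fun β' => min (1 / 40) (powScale (1 / 2) β' * btLog β')) β x) (coreWeight L (powScale 1 β) (5 * (powScale (1 / 2) β * btLog β ^ 2))) (orthoTube L 1 v') 1 - c₁ β * ((stiffGaussTop L (β / 2) β * Real.exp (-stiffGaussExp L (β / 2) β (linkEmbed L v'))) / (∫ u, ({u : GaugeConfig 3 1 SU2 | (∀ k : Fin 3, ‖su2Quat (u (0, k)) - 1‖ ≤ (powScale (1 / 3) β)) ∧ (L : ℝ) ^ 3 * wilsonAction su2Rep u ≤ (powScale (1 / 2) β)}.indicator (fun _ => (1 : ℝ))) u * (transferKernel su2Rep ((L : ℝ) ^ 3 * β) (1 : GaugeConfig 3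 1 SU2) u / transferKernel su2Rep ((L : ℝ) ^ 3 * β) (1 : GaugeConfig 3 1 SU2) 1) ∂configMeasure SU2 1))| ≤ η β * (c₁ β * ((stiffGaussTop L (β / 2) β * Real.exp (-stiffGaussExp L (β / 2) β (linkEmbed L v'))) / (∫ u, ({u : GaugeConfig 3 1 SU2 | (∀ k : Fin 3, ‖su2Quat (u (0, k)) - 1‖ ≤ (powScale (1 / 3) β)) ∧ (L : ℝ) ^ 3 * wilsonAction su2Rep u ≤ (powScale (1 / 2) β)}.indicator (fun _ => (1 : ℝ))) u * (transferKernel su2Rep ((L : ℝ) ^ 3 * β) (1 : GaugeConfig 3 1 SU2) u / transferKernel su2Rep ((L : ℝ) ^ 3 * β) (1 : GaugeConfig 3 1 SU2) 1) ∂configMeasure SU2 1)))) := fun L _ hL =>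
  Summit.QuantumFields.YangMills.Theorems.FemtoTransferGap.TwoLattice.ConstTube.stub_C1rate L hL

/-- (v8: NO LONGER A STUB) the action-free SHELL GAIN at the radii the two-zone glue needs, `InnerShellGainAt L (β^{-1/6}) (β^{-1/40})` for every `L ≥ 2`: lane A's
UNCONDITIONAL small-action shell gain ✓`shellGain_record` at inner exponent `a = 1/6 < 1/5` (outer exponent free), then ✓`innerShellGainAt_of_small_record` (action phase split at
`η = β^{-17/20}`).  (The formerly registered `stub_shellGainSmall` asked for `a = 1/5`, which the glue only used through core monotonicity `β^{-1/5} ≤ β^{-1/6}`.) [cite: Luscher1983, §3] -/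
theorem shellGain_sixth :
    ∀ (L : ℕ) [NeZero L], 2 ≤ L → InnerShellGainAt L (powScale (1 / 6)) (powScale (1 / 40)) := fun L _ hL =>
  innerShellGainAt_of_small_record (shellGain_record (L := L) hL (a := 1 / 6) (by norm_num) (by norm_num) (1 / 40))

/-- `L ≥ 2` has a non-zero site. [folklore] -/
theorem nonempty_nzSite (L : ℕ) [NeZero L] (hL : 2 ≤ L) : Nonempty (NzSite L) := by
  haveI : Fact (1 < L) := ⟨hL⟩
  exact ⟨⟨fun _ => 1, fun h => one_ne_zero (congrFun h 0)⟩⟩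

/-- ★ v6's stub `stub_hODpot_A` — the (B-OD) BRICK WITH SECOND-MOMENT POTENTIAL at rate `b_A² = O(λ_b(L³β)²)` for the un-normalised record profile, VERBATIM as registered in
skeleton v6 — is a THEOREM modulo `stub_C1rate`: `…HODPotA.hODpot_A_of_quasimode` (g19). [cite: Luscher1983, §3] -/
theorem hODpot_A_of_stub :
    ∀ (L : ℕ) [NeZero L], 2 ≤ L → ∃ M₂ : ℝ, ∀ M : ℝ, M₂ ≤ M → ∃ (bA : ℝ → ℝ) (κA : ℝ), 0 ≤ κA ∧ (∀ β, 0 ≤ bA β) ∧ (∃ a : ℝ, ∀ᶠ β : ℝ in atTop, bA β ^ 2 ≤ a * bareLambda ((L : ℝ) ^ 3 * β) ^ 2) ∧ ∀ᶠ β : ℝ in atTop, ∀ (φ : GaugeConfig 3 1 SU2 → ℝ) (v : GaugeConfig 3 L SU2 → ℝ), Measurable φ → (∃ C : ℝ, ∀ u, |φ u| ≤ C) → (∀ (g : Site 3 1 → SU2) (u : GaugeConfig 3 1 SU2), φ (gaugeTransform g u) = φ u) → (∀ u, φ u ≠ 0 → orbitDist u < max 1 ((Fintype.card (Site 3 L)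 : ℝ) / 7) * recordDelta1 L (1 / 6) β) → Measurable v → (∃ C : ℝ, ∀ U, |v U| ≤ C) → (∀ U, v U ≠ 0 → recordChi L (1 / 6) (42 * max 1 ((Fintype.card (Site 3 L) : ℝ) / 7) + 1) M β U ≠ 0) → (∀ u, fibreInner L (softWeight (recordChi L (1 / 6) (42 * max 1 ((Fintype.card (Site 3 L) : ℝ) / 7) + 1) M β)) (recordProfile L β) v u = 0) → |tubeCross β (boFun L φ (recordProfile L β)) v| ≤ (btC L β (recordProfile L β) (btEps β) (5 * (powScale (1 / 2) β * btLog β ^ 2)) / fpZ (btEps β) / recordGamma L (recordProfile L) β * levelValue su2Rep 1 ((L : ℝ) ^ 3 * β) 0) * Real.sqrt (bA β ^ 2 * tubeNormSq (softWeight (recordChi L (1 / 6) (42 * max 1 ((Fintype.card (Site 3 L) : ℝ) / 7) + 1) M β)) (boFun L φ (recordProfile L β)) + κA * recordGamma L (recordProfile L) β * ∫ u, (if orbitDist u < max 1 ((Fintype.card (Site 3 L) : ℝ) / 7) * recordDelta1 L (1 / 6) β then orbitDist u ^ 2 else 0) * φ u ^ 2 ∂configMeasure SU2 1) * Real.sqrt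 (tubeNormSq (softWeight (recordChi L (1 / 6) (42 * max 1 ((Fintype.card (Site 3 L) : ℝ) / 7) + 1) M β)) v) ∧ |tubeCross β v (boFun L φ (recordProfile L β))| ≤ (btC L β (recordProfile L β) (btEps β) (5 * (powScale (1 / 2) β * btLog β ^ 2)) / fpZ (btEps β) / recordGamma L (recordProfile L) β * levelValue su2Rep 1 ((L : ℝ) ^ 3 * β) 0) * Real.sqrt (bA β ^ 2 * tubeNormSq (softWeight (recordChi L (1 / 6) (42 * max 1 ((Fintype.card (Site 3 L) : ℝ) / 7) + 1) M β)) (boFun L φ (recordProfile L β)) + κA * recordGamma L (recordProfile L) β * ∫ u, (if orbitDist u < max 1 ((Fintype.card (Site 3 L) : ℝ) / 7) * recordDelta1 L (1 / 6) β then orbitDist u ^ 2 else 0) * φ u ^ 2 ∂configMeasure SU2 1) * Real.sqrt (tubeNormSq (softWeight (recordChi L (1 / 6) (42 * max 1 ((Fintype.card (Site 3 L) : ℝ) / 7) + 1) M β)) v) := by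
  intro L _ hL
  obtain ⟨c₁, η, hr, hq⟩ := stub_C1rate L hL
  exact hODpot_A_of_quasimode (L := L) (nonempty_nzSite L hL) hL hq hr

/-- ★ THE CORE RATE for one `L ≥ 2` from the two analytic stubs: `recordProfile_analyticInput_of_hST_hOD` inhabits `AnalyticRatePotInput L D_L M`, then the route of record
`toRecord → boRateBricksPot_record → softTubeBORatePackagePotOn_of_bricksPot (EM) → innerRateAt_of_ratePackagePot` at level `k = 1`. [cite: Luscher1983, §3] -/
theorem coreRate_of_stubs (L : ℕ) [NeZero L] (hL : 2 ≤ L) :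
    ∃ C βc : ℝ, ∀ β : ℝ, βc ≤ β →
      ∀ F : Fin 2 → (GaugeConfig 3 L SU2 → ℝ), (∀ i, IsPhys (F i)) →
        (∀ i U, F i U ≠ 0 → ∃ z : Fin 3 → Bool, orbitDist (TT.twist3 z U) < powScale (1 / 6) β) →
        (∀ a : Fin 2 → ℝ, a ≠ 0 → 0 < l2 (fun U => ∑ i, a i * F i U) (fun U => ∑ i, a i * F i U)) →
          ∃ a : Fin 2 → ℝ, a ≠ 0 ∧
            qform su2Rep β (fun U => ∑ i, a i * F i U) (fun U => ∑ i, a i * F i U) * levelValue su2Rep 1 ((L : ℝ) ^ 3 * β) 0 ≤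
              Real.exp (C * bareLambda ((L : ℝ) ^ 3 * β) ^ 2) * levelValue su2Rep 1 ((L : ℝ) ^ 3 * β) 1 *
                levelValue su2Rep L β 0 * l2 (fun U => ∑ i, a i * F i U) (fun U => ∑ i, a i * F i U) := by
  have hNz := nonempty_nzSite L hL
  have hD1 : (1 : ℝ) ≤ max 1 ((Fintype.card (Site 3 L) : ℝ) / 7) := le_max_left _ _
  have hD7 : (Fintype.card (Site 3 L) : ℝ) ≤ 7 * max 1 ((Fintype.card (Site 3 L) : ℝ) / 7) := by
    have := le_max_right (1 : ℝ) ((Fintype.card (Site 3 L) : ℝ) / 7); linarith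
  obtain ⟨M₀, hM₀, hP⟩ := recordProfile_analyticInput_of_hST_hOD (L := L) hL hNz hD1 (fun β => 5 * (powScale (1 / 2) β * btLog β ^ 2))
  obtain ⟨M₁, hST⟩ := stub_hST_A L hL
  obtain ⟨M₂, hOD⟩ := hODpot_A_of_stub L hL
  obtain ⟨θA, hθA0, hθA1, hSTM⟩ := hST (max M₀ (max M₁ M₂)) ((le_max_left _ _).trans (le_max_right _ _))
  obtain ⟨bA, κA, hκA, hbA0, hbAs, hODM⟩ := hOD (max M₀ (max M₁ M₂)) ((le_max_right _ _).trans' (le_max_right _ _))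
  obtain ⟨I⟩ := hP (max M₀ (max M₁ M₂)) (le_max_left _ _) θA hθA0 hθA1 hSTM bA κA hκA hbA0 hbAs hODM
  have hM2 : (2 : ℝ) ≤ max M₀ (max M₁ M₂) := hM₀.trans (le_max_left _ _)
  exact innerRateAt_of_ratePackagePot (L := L) 1 (fun β => powScale_pos (1 / 6) β) powScale_sixth_eventually_le
    (softTubeAdmissible_recordChi' (1 / 6) (42 * max 1 ((Fintype.card (Site 3 L) : ℝ) / 7) + 1) (max M₀ (max M₁ M₂)) (by linarith) hM2)
    (softTubeBORatePackagePotOn_of_bricksPot oneSiteEigenMoments (boRateBricksPot_record (by norm_num) (by linarith) (I.toRecord hD1 hD7 (by linarith))))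

/-- ★ The crux BY NAME from exactly the ONE declared stub (v8): the core rate for every `L ≥ 2` (`coreRate_of_stubs`: `stub_hST_A` + `hODpot_A_of_stub` (← ✓`stub_C1rate`) through the analytic rate input of
record) and lane A's SHELL (✓`shellGain_sixth`), glued by the rate two-zone lemma `nearFlatRatioLaw_of_coreRate_shell_pow` (IMS cut at `β^{-1/6}` costing
`O(λ_b²)λ₀`). -/
theorem NearFlatRatioLaw_holds_of_stubs : Summit.QuantumFields.YangMills.Theses.FlatTubeReduction.NearFlatRatioLaw :=
  nearFlatRatioLaw_of_coreRate_shell_pow (fun L _ hL => coreRate_of_stubs L hL) (fun L _ hL => shellGain_sixth L hL)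

end Summit.QuantumFields.YangMills.Cruxes.NearFlatRatioLaw.RatePackV6

end
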